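import Literature.AlgebraicGeometry.Motives.BaseChange
import Literature.AlgebraicGeometry.Motives.AlgPoints
import Mathlib.AlgebraicGeometry.Pullbacks
import Mathlib.AlgebraicGeometry.AffineScheme
import Mathlib.CategoryTheory.Limits.Shapes.Pullback.Pasting
import Mathlib.RingTheory.TensorProduct.Basic
import Mathlib.Analysis.Complex.Basic
import HarnessLib

/-!
# The affine charts `Spec (Γ(S₀, U) ⊗_K L)` of a base change `S₀ ⊗_{K,σ} L` and their complex points

Topic `Literature/AlgebraicGeometry/Motives`; constructions and proved lemmas only (no named facts),
companions of `BaseChange.lean` (`baseChangeHom σ : SchemeOver K ⥤ SchemeOver L`, the pullback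
functor along `Spec σ`, with projection `baseChangeHomFst σ S₀ = pullback.fst`). For an affine open
`U ⊆ S₀` with coordinate ring `A = Γ(S₀, U)` (a `K`-algebra through `Spec A → S₀ → Spec K`,
`affineOpenStructureHom`, `affineOpenAlgebra`), the open subscheme `π⁻¹U` of
`S = S₀ ×_{Spec K} Spec ℂ` is the affine scheme `Spec (A ⊗_K ℂ)` (Hartshorne II.3: fibre products
of affine schemes are `Spec` of tensor products; the fibre product is covered by the `π⁻¹U`):

* `baseChangeChart σ S₀ hU : Spec (Γ(S₀, U) ⊗_K ℂ) ⟶ S₀ ×_K Spec ℂ` — the chart, composed of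
  Mathlib's `pullbackSpecIso`, the pasting isomorphism `pullbackRightPullbackFstIso` and the base
  change `pullback.snd` of the open immersion `Spec Γ(S₀, U) → S₀` (`IsAffineOpen.fromSpec`); an
  open immersion (`isOpenImmersion_baseChangeChart`) with range `π⁻¹U` (`range_baseChangeChart`),
  compatible with the two projections (`baseChangeChart_comp_fst`: `r ↦ r ⊗ 1` then `Spec A → S₀`;
  `baseChangeChart_comp_snd`: `c ↦ 1 ⊗ c`);
* complex points through the chart: `fst_base_chart_point` (the point of `S₀` under the complex
  point `Spec ℂ → Spec (A ⊗ ℂ) → S` given by `χ : A ⊗_K ℂ → ℂ` is the point of `Spec A` given by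
  `χ(– ⊗ 1)`), `chart_point_comp_snd`, `eq_closedPoint_complex`, `Spec_map_comp_closedPoint_eq`
  (composing with an injective endomorphism of `ℂ` does not move the point of `Spec A`).

Written for `L = ℂ` (the consumer, `HodgeTheory/QbarGenericPointsDense.lean`, conjugates complex
points); the underlying scheme of `(baseChangeHom σ).obj S₀` is `pullback S₀.hom (Spec.map σ)` by
`rfl`, and the statements are phrased with `pullback.fst/snd` literally so that instance search
for open immersions sees through them.

## References

* R. Hartshorne, *Algebraic Geometry* (1977), II §3, Thm. 3.3 (fibre products; Step 3–4 of the
  proof: affine case `Spec A ×_{Spec R} Spec B = Spec (A ⊗_R B)` and gluing over affine opens).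
  [Hartshorne1977]
-/

noncomputable section

open CategoryTheory CategoryTheory.Limits AlgebraicGeometry TensorProduct

namespace Literature.AlgebraicGeometry.Motives

section Chart

variable {K : Type} [Field K] (σ : K →+* ℂ) (S₀ : SchemeOver K)
  {U : S₀.left.Opens} (hU : IsAffineOpen U)

/-- The `K`-algebra structure map of the coordinate ring of an affine open `U ⊆ S₀`:
`Spec Γ(S₀, U) → S₀ → Spec K` is `Spec` of it. [folklore] -/
def affineOpenStructureHom : CommRingCat.of K ⟶ Γ(S₀.left, U) :=
  Spec.preimage (hU.fromSpec ≫ S₀.hom)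

/-- `Spec` of the structure map is `Spec Γ(S₀, U) → S₀ → Spec K`. [folklore] -/
theorem Spec_map_affineOpenStructureHom :
    Spec.map (affineOpenStructureHom S₀ hU) = hU.fromSpec ≫ S₀.hom :=
  Spec.map_preimage _

/-- The `K`-algebra structure on the coordinate ring `Γ(S₀, U)` of an affine open of a
`K`-scheme. [folklore] -/
abbrev affineOpenAlgebra : Algebra K Γ(S₀.left, U) :=
  (affineOpenStructureHom S₀ hU).hom.toAlgebra

/-- `Spec Γ(S₀, U) → S₀ → Spec K` is `Spec` of the algebra structure map. [folklore] -/
theorem fromSpec_comp_hom_eq :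
    letI := affineOpenAlgebra S₀ hU
    hU.fromSpec ≫ S₀.hom = Spec.map (CommRingCat.ofHom (algebraMap K Γ(S₀.left, U))) := by
  rw [← Spec_map_affineOpenStructureHom]
  rfl

/-- The chart `Spec (Γ(S₀, U) ⊗_K ℂ) ⟶ S₀ ×_K Spec ℂ` over an affine open `U ⊆ S₀` (the
underlying scheme of `S₀ ⊗_σ ℂ = (baseChangeHom σ).obj S₀` is this fibre product, by
`rfl`). [folklore] -/
def baseChangeChart :
    letI := affineOpenAlgebra S₀ hU
    letI := σ.toAlgebra
    Spec (.of (Γ(S₀.left, U) ⊗[K] ℂ)) ⟶ pullback S₀.hom (Spec.map (CommRingCat.ofHom σ)) :=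
  letI := affineOpenAlgebra S₀ hU
  letI := σ.toAlgebra
  (pullbackSpecIso K Γ(S₀.left, U) ℂ).inv ≫
    (pullback.congrHom (fromSpec_comp_hom_eq S₀ hU)
      (show Spec.map (CommRingCat.ofHom σ) = Spec.map (CommRingCat.ofHom (algebraMap K ℂ)) from
        rfl)).inv ≫
    (pullbackRightPullbackFstIso S₀.hom (Spec.map (CommRingCat.ofHom σ)) hU.fromSpec).inv ≫
    pullback.snd hU.fromSpec (pullback.fst S₀.hom (Spec.map (CommRingCat.ofHom σ)))

/-- The chart is an open immersion. [folklore] -/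
instance isOpenImmersion_baseChangeChart : IsOpenImmersion (baseChangeChart σ S₀ hU) := by
  unfold baseChangeChart
  infer_instance

/-- The chart followed by the projection to `S₀` is `Spec` of `r ↦ r ⊗ 1` followed by the
inclusion of the affine open. [folklore] -/
theorem baseChangeChart_comp_fst :
    letI := affineOpenAlgebra S₀ hU
    letI := σ.toAlgebra
    baseChangeChart σ S₀ hU ≫ pullback.fst S₀.hom (Spec.map (CommRingCat.ofHom σ)) =
      Spec.map (CommRingCat.ofHom
        (Algebra.TensorProduct.includeLeftRingHom : Γ(S₀.left, U) →+* Γ(S₀.left, U) ⊗[K] ℂ)) ≫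
        hU.fromSpec := by
  letI := affineOpenAlgebra S₀ hU
  letI := σ.toAlgebra
  have hc : pullback.snd hU.fromSpec (pullback.fst S₀.hom (Spec.map (CommRingCat.ofHom σ))) ≫
      pullback.fst S₀.hom (Spec.map (CommRingCat.ofHom σ)) =
      pullback.fst hU.fromSpec (pullback.fst S₀.hom (Spec.map (CommRingCat.ofHom σ))) ≫
        hU.fromSpec :=
    pullback.condition.symm
  unfold baseChangeChart
  simp only [Category.assoc]
  rw [hc, pullbackRightPullbackFstIso_inv_fst_assoc, pullback.congrHom_inv,
    pullback.lift_fst_assoc, Category.comp_id, pullbackSpecIso_inv_fst_assoc]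

/-- The chart followed by the projection to `Spec ℂ` is `Spec` of `c ↦ 1 ⊗ c`. [folklore] -/
theorem baseChangeChart_comp_snd :
    letI := affineOpenAlgebra S₀ hU
    letI := σ.toAlgebra
    baseChangeChart σ S₀ hU ≫ pullback.snd S₀.hom (Spec.map (CommRingCat.ofHom σ)) =
      Spec.map (CommRingCat.ofHom (Algebra.TensorProduct.includeRight.toRingHom :
        ℂ →+* Γ(S₀.left, U) ⊗[K] ℂ)) := by
  letI := affineOpenAlgebra S₀ hU
  letI := σ.toAlgebra
  unfold baseChangeChart
  simp only [Category.assoc]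
  rw [pullbackRightPullbackFstIso_inv_snd_snd, pullback.congrHom_inv, pullback.lift_snd,
    Category.comp_id, pullbackSpecIso_inv_snd]
  rfl

/-- The range of the chart is the preimage of `U`. [folklore] -/
theorem range_baseChangeChart :
    Set.range (baseChangeChart σ S₀ hU) =
      (pullback.fst S₀.hom (Spec.map (CommRingCat.ofHom σ))) ⁻¹' (U : Set S₀.left) := by
  rw [← Scheme.Hom.coe_opensRange]
  unfold baseChangeChart
  rw [Scheme.Hom.opensRange_comp_of_isIso, Scheme.Hom.opensRange_comp_of_isIso,
    Scheme.Hom.opensRange_comp_of_isIso, Scheme.Hom.opensRange_pullbackSnd,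
    IsAffineOpen.opensRange_fromSpec]
  rfl

end Chart

/-! ### Complex points through the chart -/

section Points

variable {K : Type} [Field K] (σ : K →+* ℂ) (S₀ : SchemeOver K)

/-- Every point of `Spec ℂ` is the closed point. [folklore] -/
theorem eq_closedPoint_complex (z : Spec (CommRingCat.of ℂ)) : z = IsLocalRing.closedPoint ℂ :=
  Subsingleton.elim (α := PrimeSpectrum ℂ) _ _

/-- Composing a complex point of `Spec R` with an injective endomorphism of `ℂ` does not change
the underlying point of `Spec R` (both are the kernel). [folklore] -/
theorem Spec_map_comp_closedPoint_eq {R : Type} [CommRing R] (α : R →+* ℂ) (τ : ℂ →+* ℂ)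
    (hτ : Function.Injective τ) :
    (Spec.map (CommRingCat.ofHom (τ.comp α))).base (IsLocalRing.closedPoint ℂ) =
      (Spec.map (CommRingCat.ofHom α)).base (IsLocalRing.closedPoint ℂ) := by
  change PrimeSpectrum.comap (τ.comp α) (IsLocalRing.closedPoint ℂ) =
    PrimeSpectrum.comap α (IsLocalRing.closedPoint ℂ)
  ext1
  change Ideal.comap (τ.comp α) (IsLocalRing.maximalIdeal ℂ) =
    Ideal.comap α (IsLocalRing.maximalIdeal ℂ)
  rw [IsLocalRing.maximalIdeal_eq_bot, ← Ideal.comap_comap, Ideal.comap_bot_of_injective τ hτ]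

/-- In the chart, the projection to `S₀` of the complex point `Spec ℂ → Spec (Γ(S₀,U) ⊗ ℂ) → S`
given by `χ : Γ(S₀, U) ⊗_K ℂ → ℂ` is the point of `Spec Γ(S₀, U)` given by `χ(– ⊗ 1)`.
[folklore] -/
theorem fst_base_chart_point {U : S₀.left.Opens} (hU : IsAffineOpen U)
    (χ : (letI := affineOpenAlgebra S₀ hU; letI := σ.toAlgebra;
      CommRingCat.of (Γ(S₀.left, U) ⊗[K] ℂ)) ⟶ CommRingCat.of ℂ) :
    letI := affineOpenAlgebra S₀ hU
    letI := σ.toAlgebra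
    (pullback.fst S₀.hom (Spec.map (CommRingCat.ofHom σ))).base
        ((Spec.map χ ≫ baseChangeChart σ S₀ hU).base (IsLocalRing.closedPoint ℂ)) =
      hU.fromSpec.base ((Spec.map (CommRingCat.ofHom
        (χ.hom.comp Algebra.TensorProduct.includeLeftRingHom))).base
          (IsLocalRing.closedPoint ℂ)) := by
  letI := affineOpenAlgebra S₀ hU
  letI := σ.toAlgebra
  rw [← Scheme.Hom.comp_apply, Category.assoc, baseChangeChart_comp_fst, ← Category.assoc,
    ← Spec.map_comp, Scheme.Hom.comp_apply]
  rfl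

/-- In the chart, the complex point given by `χ` followed by the projection to `Spec ℂ` is
`Spec` of `χ(1 ⊗ –)`. [folklore] -/
theorem chart_point_comp_snd {U : S₀.left.Opens} (hU : IsAffineOpen U)
    (χ : (letI := affineOpenAlgebra S₀ hU; letI := σ.toAlgebra;
      CommRingCat.of (Γ(S₀.left, U) ⊗[K] ℂ)) ⟶ CommRingCat.of ℂ) :
    letI := affineOpenAlgebra S₀ hU
    letI := σ.toAlgebra
    (Spec.map χ ≫ baseChangeChart σ S₀ hU) ≫
        pullback.snd S₀.hom (Spec.map (CommRingCat.ofHom σ)) =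
      Spec.map (CommRingCat.ofHom (χ.hom.comp
        (Algebra.TensorProduct.includeRight (R := K) (A := Γ(S₀.left, U)) (B := ℂ)).toRingHom)) := by
  letI := affineOpenAlgebra S₀ hU
  letI := σ.toAlgebra
  rw [Category.assoc, baseChangeChart_comp_snd, ← Spec.map_comp]
  rfl


end Points

end Literature.AlgebraicGeometry.Motives

end
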